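import Mathlib
import HarnessLib
import Literature.Analysis.FluidPDE.VectorCalculus
import Summits.NavierStokesRegularity.NavierStokesRegularity.Theorems.UnthreadedRigidityDoorUnthreadedRigidityVirialHornAngularLemma
import Summits.NavierStokesRegularity.NavierStokesRegularity.Theorems.UnthreadedRigidityDoorUnthreadedRigidityThreadingJetsVirialFields
import Summits.NavierStokesRegularity.NavierStokesRegularity.Theorems.UnthreadedRigidityDoorUnthreadedRigidityCoZonalTransfer

/-!
# W2 door `UnthreadedRigidity` — LINE g12-1 «CO-ZONAL»: support CZ-a `CommutingAngularSilence`, II — the engine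

engine-1 g71 (KEY-NS #205 (d)).  Two solid harmonics `Y₁, Y₂` of DIFFERENT degrees that Poisson-commute (`{Y₁,Y₂} ≡ 0`), with
`Y₂ ≢ 0`, have `𝒜(Y₁) = {Y₁,|∇Y₁|²} ≡ 0`.  THE TRANSFER LAW: on the dense open set `U = {R₂ = y × ∇Y₂ ≠ 0}` one has
`∇Y₁ = λ∇Y₂ + μy` with `λ = ⟪R₁,R₂⟫/|R₂|²`, `μ = (l₁Y₁ − λl₂Y₂)/|y|²` smooth; differentiating (this file's POINTWISE PACKAGE, §1):
`D(∇Y₁)w = (Dλw)∇Y₂ + λD(∇Y₂)w + (Dμw)y + μw`, whence by symmetry of the Hessians, Euler and the traces: `Dλ(R₂) = Dμ(R₂) = 0`,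
`Dλ(y) = (l₁−l₂)λ`, `Dμ(y) = (l₁−2)μ`, `Dλ(∇Y₂) = −(l₁+1)μ`, and `𝒜(Y₁) = λ³𝒜(Y₂)`.  §2 THE SECOND-ORDER STEP (symmetric `D²λ`):
`(Dλ·τ₂)·𝒜(Y₂) = 0` (`τ₂ = R₂ × y`).  §3 THE ALTERNATIVE on `V = U ∩ {𝒜(Y₁) ≠ 0}`: there `l₁(l₁+1)Y₁ = l₂(l₂+1)λY₂`, whose
derivative along `τ₂` gives `(l₁(l₁+1) − l₂(l₂+1))λ|R₂|² = 0`, i.e. `λ = 0` — contradiction; so `𝒜(Y₁) = 0` on `U`.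

LABEL: support lemma of a MODEL line (W2 door, item 27585 OPEN); multivariable calculus of explicit fields; not a statement about
the Navier–Stokes equations.  0 kit.
-/

-- the summit and its single sub-problem share the name (CONVENTIONS §1), as in every Theorems file
set_option linter.dupNamespace false

namespace Summit.NavierStokesRegularity.NavierStokesRegularity.Theorems.UnthreadedRigidity.CoZonal

open scoped Topology InnerProductSpace
open Filter Set
open Literature.Analysis.FluidPDE (cross crossCLM crossCLM_apply hasFDerivAt_cross)
open Summit.NavierStokesRegularity.NavierStokesRegularity.Theorems.UnthreadedRigidity.VirialHorn
open Summit.NavierStokesRegularity.NavierStokesRegularity.Theorems.UnthreadedRigidity.ProfileHorn (E3)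
open Summit.NavierStokesRegularity.NavierStokesRegularity.Theorems.UnthreadedRigidity.ThreadingJets (contDiff_cross_gradient
  contDiff_angForm)

/-! ## §0 Coordinates (private copies, as in the other files of this door) -/

/-- components of the cross product. -/
private theorem cross_apply_zero (u v : E3) : cross u v 0 = u 1 * v 2 - u 2 * v 1 := by simp [cross, cross_apply]
/-- components of the cross product. -/
private theorem cross_apply_one (u v : E3) : cross u v 1 = u 2 * v 0 - u 0 * v 2 := by simp [cross, cross_apply]
/-- components of the cross product. -/
private theorem cross_apply_two (u v : E3) : cross u v 2 = u 0 * v 1 - u 1 * v 0 := by simp [cross, cross_apply]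
/-- the inner product in coordinates. -/
private theorem real_inner_e3 (u v : E3) : ⟪u, v⟫_ℝ = u 0 * v 0 + u 1 * v 1 + u 2 * v 2 := by
  simp [PiLp.inner_apply, Fin.sum_univ_three, mul_comm]

/-- `⟪u × v, w⟫ = −⟪u × w, v⟫`. -/
private theorem inner_cross_swap (u v w : E3) : ⟪cross u v, w⟫_ℝ = -⟪cross u w, v⟫_ℝ := by
  simp only [real_inner_e3, cross_apply_zero, cross_apply_one, cross_apply_two]; ring

/-- `DY(y) v = ⟪∇Y(y), v⟫`. -/
private theorem fderiv_apply_eq_inner_gradient (Y : E3 → ℝ) (y v : E3) : fderiv ℝ Y y v = ⟪gradient Y y, v⟫_ℝ := by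
  rw [gradient, InnerProductSpace.toDual_symm_apply]

/-! ## §2 The second-order step -/

section SecondOrder

variable {l₁ l₂ : ℕ} {Y₂ : E3 → ℝ} {lam mu : E3 → ℝ} {y : E3}

/-- ★ THE «G″» STEP: if near `y` one has `Dλ(∇Y₂) = −(l₁+1)μ` and `Dλ(R₂) = 0`, with `λ ∈ C²`, `μ` differentiable and
`Dμ(y)(R₂) = 0`, then `(Dλ(y)·τ₂) · 𝒜(Y₂)(y) = 0` (`τ₂ = R₂ × y`).  Differentiating the first identity along `R₂` and the second
along `∇Y₂` and using the symmetry of `D²λ` gives `Dλ(D(∇Y₂)R₂) = Dλ(y × D(∇Y₂)∇Y₂)`; resolving `Dλ` in the frame `(y, τ₂, R₂)`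
(`VirialHorn.frame_resolution`) both sides are `± Dλ(τ₂)·𝒜(Y₂)/(2|R₂|²)`. -/
theorem transfer_beta_angForm (hY₂ : IsSolidHarmonic l₂ Y₂) (hlam : ContDiffAt ℝ 2 lam y)
    (hmu : DifferentiableAt ℝ mu y)
    (hΦ : ∀ᶠ z in 𝓝 y, fderiv ℝ lam z (gradient Y₂ z) = -(((l₁ : ℝ) + 1) * mu z))
    (hΨ : ∀ᶠ z in 𝓝 y, fderiv ℝ lam z (cross z (gradient Y₂ z)) = 0)
    (hMR : fderiv ℝ mu y (cross y (gradient Y₂ y)) = 0) (hR : cross y (gradient Y₂ y) ≠ 0) :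
    fderiv ℝ lam y (cross (cross y (gradient Y₂ y)) y) * angForm Y₂ y = 0 := by
  have hy : y ≠ 0 := ne_zero_of_rot_ne_zero hR
  -- derivative data
  have hL1 : ContDiffAt ℝ 1 (fderiv ℝ lam) y := hlam.fderiv_right (by norm_num)
  have hLd : HasFDerivAt (fderiv ℝ lam) (fderiv ℝ (fderiv ℝ lam) y) y := (hL1.differentiableAt (by simp)).hasFDerivAt
  have hsymm : ∀ v w : E3, fderiv ℝ (fderiv ℝ lam) y v w = fderiv ℝ (fderiv ℝ lam) y w v :=
    fun v w => hlam.isSymmSndFDerivAt (by simp) v w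
  have hg : HasFDerivAt (gradient Y₂) (fderiv ℝ (gradient Y₂) y) y :=
    ((hY₂.contDiff_gradient.differentiable (by simp)) y).hasFDerivAt
  have hRot := hY₂.hasFDerivAt_rot y
  -- (P1): derivative of `z ↦ Dλ(z)(∇Y₂ z) + (l₁+1) μ z ≡ 0`
  have hΦd := (hLd.clm_apply hg).add (hmu.hasFDerivAt.const_mul ((l₁ : ℝ) + 1))
  have hΦ0 : fderiv ℝ (fun z : E3 => fderiv ℝ lam z (gradient Y₂ z) + ((l₁ : ℝ) + 1) * mu z) y = 0 := by
    have : (fun z : E3 => fderiv ℝ lam z (gradient Y₂ z) + ((l₁ : ℝ) + 1) * mu z) =ᶠ[𝓝 y] fun _ => (0 : ℝ) := by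
      filter_upwards [hΦ] with z hz
      rw [hz]; ring
    rw [this.fderiv_eq, fderiv_const_apply]
  have hP1 : ∀ w : E3, fderiv ℝ (fderiv ℝ lam) y w (gradient Y₂ y) + fderiv ℝ lam y (fderiv ℝ (gradient Y₂) y w)
      + ((l₁ : ℝ) + 1) * fderiv ℝ mu y w = 0 := by
    intro w
    have h := congrArg (fun L : E3 →L[ℝ] ℝ => L w) (hΦd.fderiv.symm.trans hΦ0)
    simp only [_root_.add_apply, _root_.smul_apply, ContinuousLinearMap.comp_apply, ContinuousLinearMap.flip_apply,
      _root_.zero_apply, smul_eq_mul] at h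
    linarith
  -- (P2): derivative of `z ↦ Dλ(z)(z × ∇Y₂ z) ≡ 0`
  have hΨd := hLd.clm_apply hRot
  have hΨ0 : fderiv ℝ (fun z : E3 => fderiv ℝ lam z (cross z (gradient Y₂ z))) y = 0 := by
    have : (fun z : E3 => fderiv ℝ lam z (cross z (gradient Y₂ z))) =ᶠ[𝓝 y] fun _ => (0 : ℝ) := hΨ
    rw [this.fderiv_eq, fderiv_const_apply]
  have hP2 : ∀ w : E3, fderiv ℝ (fderiv ℝ lam) y w (cross y (gradient Y₂ y))
      + fderiv ℝ lam y (cross y (fderiv ℝ (gradient Y₂) y w)) + fderiv ℝ lam y (cross w (gradient Y₂ y)) = 0 := by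
    intro w
    have h := congrArg (fun L : E3 →L[ℝ] ℝ => L w) (hΨd.fderiv.symm.trans hΨ0)
    simp only [_root_.add_apply, ContinuousLinearMap.comp_apply, ContinuousLinearMap.flip_apply,
      _root_.zero_apply, ContinuousLinearMap.precompR_apply, ContinuousLinearMap.compL_apply,
      ContinuousLinearMap.precompL_apply, Literature.Analysis.FluidPDE.crossCLM_apply,
      ContinuousLinearMap.id_apply, map_add] at h
    linarith
  -- (I1'): `Dλ(H₂ R₂) = Dλ(y × H₂ ∇Y₂)`
  have e1 := hP1 (cross y (gradient Y₂ y))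
  have e2 := hP2 (gradient Y₂ y)
  have hgg : cross (gradient Y₂ y) (gradient Y₂ y) = 0 := by
    ext i; fin_cases i <;> simp [cross_apply_zero, cross_apply_one, cross_apply_two] <;> ring
  rw [hMR, mul_zero, add_zero] at e1
  rw [hgg, map_zero, add_zero, hsymm] at e2
  have hI : fderiv ℝ lam y (fderiv ℝ (gradient Y₂) y (cross y (gradient Y₂ y)))
      = fderiv ℝ lam y (cross y (fderiv ℝ (gradient Y₂) y (gradient Y₂ y))) := by linarith
  -- frame resolution of `Dλ` (with `Dλ(R₂) = 0`)
  have hΛR : fderiv ℝ lam y (cross y (gradient Y₂ y)) = 0 := hΨ.self_of_nhds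
  have hres : ∀ X : E3, (⟪y, y⟫_ℝ * ⟪cross y (gradient Y₂ y), cross y (gradient Y₂ y)⟫_ℝ) * fderiv ℝ lam y X =
      (⟪cross y (gradient Y₂ y), cross y (gradient Y₂ y)⟫_ℝ * ⟪X, y⟫_ℝ) * fderiv ℝ lam y y
        + ⟪X, cross (cross y (gradient Y₂ y)) y⟫_ℝ * fderiv ℝ lam y (cross (cross y (gradient Y₂ y)) y) := by
    intro X
    have h := congrArg (fun v : E3 => fderiv ℝ lam y v) (frame_resolution y (gradient Y₂ y) X)
    simp only [map_add, map_smul, smul_eq_mul, hΛR, mul_zero, add_zero] at h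
    exact h
  -- the two frame components
  have hτ : cross (cross y (gradient Y₂ y)) y = ⟪y, y⟫_ℝ • gradient Y₂ y - ⟪y, gradient Y₂ y⟫_ℝ • y :=
    frame_tau_eq y (gradient Y₂ y)
  have hA : angForm Y₂ y = 2 * ⟪cross y (gradient Y₂ y), fderiv ℝ (gradient Y₂) y (gradient Y₂ y)⟫_ℝ := hY₂.angForm_eq y
  have hX1y : ⟪fderiv ℝ (gradient Y₂) y (cross y (gradient Y₂ y)), y⟫_ℝ = 0 := by
    rw [hY₂.hessian_symm, hY₂.hessian_apply_self, real_inner_smul_right, inner_cross_self_right, mul_zero]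
  have hX1τ : ⟪fderiv ℝ (gradient Y₂) y (cross y (gradient Y₂ y)), cross (cross y (gradient Y₂ y)) y⟫_ℝ =
      ⟪y, y⟫_ℝ * ⟪cross y (gradient Y₂ y), fderiv ℝ (gradient Y₂) y (gradient Y₂ y)⟫_ℝ := by
    rw [hτ, inner_sub_right, real_inner_smul_right, real_inner_smul_right, hX1y, mul_zero, sub_zero,
      hY₂.hessian_symm]
  have hX2y : ⟪cross y (fderiv ℝ (gradient Y₂) y (gradient Y₂ y)), y⟫_ℝ = 0 := inner_cross_self_left _ _
  have hX2τ : ⟪cross y (fderiv ℝ (gradient Y₂) y (gradient Y₂ y)), cross (cross y (gradient Y₂ y)) y⟫_ℝ =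
      -(⟪y, y⟫_ℝ * ⟪cross y (gradient Y₂ y), fderiv ℝ (gradient Y₂) y (gradient Y₂ y)⟫_ℝ) := by
    rw [hτ, inner_sub_right, real_inner_smul_right, real_inner_smul_right, hX2y, mul_zero, sub_zero,
      inner_cross_swap, mul_neg]
  have r1 := hres (fderiv ℝ (gradient Y₂) y (cross y (gradient Y₂ y)))
  have r2 := hres (cross y (fderiv ℝ (gradient Y₂) y (gradient Y₂ y)))
  rw [hX1y, hX1τ] at r1
  rw [hX2y, hX2τ] at r2
  have hQ : 0 < ⟪y, y⟫_ℝ := real_inner_self_pos.2 hy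
  have hfin : ⟪y, y⟫_ℝ * (fderiv ℝ lam y (cross (cross y (gradient Y₂ y)) y) * angForm Y₂ y) = 0 := by
    rw [hA]; linear_combination r2 - r1 + (⟪y, y⟫_ℝ * ⟪cross y (gradient Y₂ y), cross y (gradient Y₂ y)⟫_ℝ) * hI
  exact (mul_eq_zero.1 hfin).resolve_left hQ.ne'

end SecondOrder

/-! ## §3 The alternative: the engine -/

section Engine

variable {l₁ l₂ : ℕ} {Y₁ Y₂ : E3 → ℝ} {lam mu : E3 → ℝ}

/-- `l ↦ l(l+1)` is injective on `ℕ` (read in `ℝ`). -/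
private theorem deg_mul_succ_ne (hl : l₁ ≠ l₂) : (l₁ : ℝ) * ((l₁ : ℝ) + 1) ≠ (l₂ : ℝ) * ((l₂ : ℝ) + 1) := by
  rcases lt_or_gt_of_ne hl with h | h
  · have h' : (l₁ : ℝ) + 1 ≤ l₂ := by exact_mod_cast h
    have h0 : (0 : ℝ) ≤ l₁ := Nat.cast_nonneg l₁
    nlinarith
  · have h' : (l₂ : ℝ) + 1 ≤ l₁ := by exact_mod_cast h
    have h0 : (0 : ℝ) ≤ l₂ := Nat.cast_nonneg l₂
    nlinarith

/-- ★ THE ENGINE OF CZ-a: if on an open set `W` off the characteristic set of `Y₂` (`y × ∇Y₂ ≠ 0`) the transfer law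
`∇Y₁ = λ∇Y₂ + μy` holds with `λ ∈ C²`, `μ ∈ C¹`, and the degrees differ, then `𝒜(Y₁) = 0` on `W`.
(§1: `𝒜(Y₁) = λ³𝒜(Y₂)` and the first-order package; §2: `(Dλ·τ₂)𝒜(Y₂) = 0`; on `V = W ∩ {𝒜(Y₁) ≠ 0}` this forces
`l₁(l₁+1)Y₁ = l₂(l₂+1)λY₂`, whose `τ₂`-derivative is `(l₁(l₁+1) − l₂(l₂+1))λ|R₂|² = 0` — contradiction.) -/
theorem angForm_eq_zero_of_transfer (hY₁ : IsSolidHarmonic l₁ Y₁) (hY₂ : IsSolidHarmonic l₂ Y₂) (hl : l₁ ≠ l₂)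
    {W : Set E3} (hW : IsOpen W) (hRW : ∀ z ∈ W, cross z (gradient Y₂ z) ≠ 0)
    (hF : ∀ z ∈ W, gradient Y₁ z = lam z • gradient Y₂ z + mu z • z)
    (hlam : ∀ z ∈ W, ContDiffAt ℝ 2 lam z) (hmu : ∀ z ∈ W, DifferentiableAt ℝ mu z) :
    ∀ z ∈ W, angForm Y₁ z = 0 := by
  -- the pointwise package at every point of `W`
  have hev : ∀ z ∈ W, ∀ᶠ x in 𝓝 z, gradient Y₁ x = lam x • gradient Y₂ x + mu x • x := fun z hz => by
    filter_upwards [hW.mem_nhds hz] with x hx using hF x hx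
  have hE : ∀ z ∈ W, ∀ w : E3, fderiv ℝ (gradient Y₁) z w = fderiv ℝ lam z w • gradient Y₂ z
      + lam z • fderiv ℝ (gradient Y₂) z w + fderiv ℝ mu z w • z + mu z • w := fun z hz w =>
    hessian_transfer hY₂ (hev z hz) ((hlam z hz).differentiableAt (by simp)) (hmu z hz) w
  have hFI : ∀ z ∈ W, fderiv ℝ lam z (cross z (gradient Y₂ z)) = 0 ∧ fderiv ℝ mu z (cross z (gradient Y₂ z)) = 0 :=
    fun z hz => transfer_firstIntegrals hY₁ hY₂ (hE z hz) (hRW z hz)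
  have hΛy : ∀ z ∈ W, fderiv ℝ lam z z = ((l₁ : ℝ) - l₂) * lam z := fun z hz =>
    transfer_euler_lam hY₁ hY₂ (hF z hz) (hE z hz) (hRW z hz)
  have hMy : ∀ z ∈ W, fderiv ℝ mu z z = ((l₁ : ℝ) - 2) * mu z := fun z hz =>
    transfer_euler_mu hY₁ hY₂ (hF z hz) (hE z hz) (hRW z hz) (hΛy z hz)
  have hΛg : ∀ z ∈ W, fderiv ℝ lam z (gradient Y₂ z) = -(((l₁ : ℝ) + 1) * mu z) := fun z hz =>
    transfer_trace hY₁ hY₂ (hE z hz) (hMy z hz)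
  have hAA : ∀ z ∈ W, angForm Y₁ z = lam z ^ 3 * angForm Y₂ z := fun z hz =>
    transfer_angForm hY₁ hY₂ (hF z hz) (hE z hz)
  have hβ : ∀ z ∈ W, fderiv ℝ lam z (cross (cross z (gradient Y₂ z)) z) * angForm Y₂ z = 0 := fun z hz =>
    transfer_beta_angForm (l₁ := l₁) hY₂ (hlam z hz) (hmu z hz)
      (by filter_upwards [hW.mem_nhds hz] with x hx using hΛg x hx)
      (by filter_upwards [hW.mem_nhds hz] with x hx using (hFI x hx).1) (hFI z hz).2 (hRW z hz)
  -- the exceptional set `V = W ∩ {𝒜(Y₁) ≠ 0}` and the identity `l₁(l₁+1)Y₁ = l₂(l₂+1)λY₂` on it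
  have hI4 : ∀ z ∈ W, angForm Y₁ z ≠ 0 →
      fderiv ℝ lam z (cross (cross z (gradient Y₂ z)) z) = 0 ∧
        ((l₁ : ℝ) * ((l₁ : ℝ) + 1)) * Y₁ z = ((l₂ : ℝ) * ((l₂ : ℝ) + 1)) * (lam z * Y₂ z) := by
    intro z hzW hzA
    have hA2 : angForm Y₂ z ≠ 0 := by
      intro h0
      have := hAA z hzW
      rw [h0, mul_zero] at this
      exact hzA this
    have hτ0 : fderiv ℝ lam z (cross (cross z (gradient Y₂ z)) z) = 0 := (mul_eq_zero.1 (hβ z hzW)).resolve_right hA2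
    refine ⟨hτ0, ?_⟩
    have h1 : ⟪z, z⟫_ℝ * fderiv ℝ lam z (gradient Y₂ z) =
        fderiv ℝ lam z (cross (cross z (gradient Y₂ z)) z) + ⟪z, gradient Y₂ z⟫_ℝ * fderiv ℝ lam z z := by
      have := congrArg (fun v : E3 => fderiv ℝ lam z v) (frame_tau_eq z (gradient Y₂ z))
      simp only [map_sub, map_smul, smul_eq_mul] at this
      linarith
    rw [hτ0, zero_add, hΛg z hzW, hΛy z hzW, hY₂.inner_self_gradient] at h1
    have hFz : (l₁ : ℝ) * Y₁ z = lam z * ((l₂ : ℝ) * Y₂ z) + mu z * ⟪z, z⟫_ℝ := by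
      have := congrArg (fun v : E3 => ⟪z, v⟫_ℝ) (hF z hzW)
      simp only [inner_add_right, real_inner_smul_right, hY₁.inner_self_gradient, hY₂.inner_self_gradient] at this
      linarith
    linear_combination ((l₁ : ℝ) + 1) * hFz - h1
  -- conclusion by contradiction at a point of `V`
  intro z₀ hz₀
  by_contra hA0
  have hVopen : IsOpen (W ∩ {z : E3 | angForm Y₁ z ≠ 0}) :=
    hW.inter (isOpen_ne_fun (contDiff_angForm hY₁).continuous continuous_const)
  have hz₀V : z₀ ∈ W ∩ {z : E3 | angForm Y₁ z ≠ 0} := ⟨hz₀, hA0⟩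
  -- `Θ = l₁(l₁+1)Y₁ − l₂(l₂+1)λY₂` vanishes near `z₀`
  have hΘ : (fun z : E3 => ((l₁ : ℝ) * ((l₁ : ℝ) + 1)) * Y₁ z - ((l₂ : ℝ) * ((l₂ : ℝ) + 1)) * (lam z * Y₂ z))
      =ᶠ[𝓝 z₀] fun _ => (0 : ℝ) := by
    filter_upwards [hVopen.mem_nhds hz₀V] with z hz
    rw [(hI4 z hz.1 hz.2).2, sub_self]
  have hY₁d : DifferentiableAt ℝ Y₁ z₀ := (hY₁.contDiff.differentiable (by simp)) z₀
  have hY₂d : DifferentiableAt ℝ Y₂ z₀ := (hY₂.contDiff.differentiable (by simp)) z₀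
  have hlamd : DifferentiableAt ℝ lam z₀ := (hlam z₀ hz₀).differentiableAt (by simp)
  have hΘd : HasFDerivAt
      (fun z : E3 => ((l₁ : ℝ) * ((l₁ : ℝ) + 1)) * Y₁ z - ((l₂ : ℝ) * ((l₂ : ℝ) + 1)) * (lam z * Y₂ z))
      (((l₁ : ℝ) * ((l₁ : ℝ) + 1)) • fderiv ℝ Y₁ z₀
        - ((l₂ : ℝ) * ((l₂ : ℝ) + 1)) • (lam z₀ • fderiv ℝ Y₂ z₀ + Y₂ z₀ • fderiv ℝ lam z₀)) z₀ :=
    (hY₁d.hasFDerivAt.const_mul ((l₁ : ℝ) * ((l₁ : ℝ) + 1))).sub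
      ((hlamd.hasFDerivAt.mul hY₂d.hasFDerivAt).const_mul ((l₂ : ℝ) * ((l₂ : ℝ) + 1)))
  have h0 := congrArg (fun L : E3 →L[ℝ] ℝ => L (cross (cross z₀ (gradient Y₂ z₀)) z₀))
    (hΘd.fderiv.symm.trans (by rw [hΘ.fderiv_eq, fderiv_const_apply]))
  simp only [_root_.sub_apply, _root_.smul_apply, _root_.add_apply, _root_.zero_apply, smul_eq_mul] at h0
  -- evaluate: `DYᵢ τ₂ = ⟪∇Yᵢ, τ₂⟫`, `⟪∇Y₂, τ₂⟫ = |R₂|²`, `⟪∇Y₁, τ₂⟫ = λ|R₂|²`, `Dλ τ₂ = 0`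
  have e₁ := fderiv_apply_eq_inner_gradient Y₁ z₀ (cross (cross z₀ (gradient Y₂ z₀)) z₀)
  have e₂ := fderiv_apply_eq_inner_gradient Y₂ z₀ (cross (cross z₀ (gradient Y₂ z₀)) z₀)
  have f2 : ⟪gradient Y₂ z₀, cross (cross z₀ (gradient Y₂ z₀)) z₀⟫_ℝ =
      ⟪cross z₀ (gradient Y₂ z₀), cross z₀ (gradient Y₂ z₀)⟫_ℝ := by
    rw [real_inner_comm]; exact inner_tau_g z₀ (gradient Y₂ z₀)
  have f3 : ⟪z₀, cross (cross z₀ (gradient Y₂ z₀)) z₀⟫_ℝ = 0 := by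
    rw [real_inner_comm]; exact inner_cross_self_right _ _
  have f1 : ⟪gradient Y₁ z₀, cross (cross z₀ (gradient Y₂ z₀)) z₀⟫_ℝ =
      lam z₀ * ⟪cross z₀ (gradient Y₂ z₀), cross z₀ (gradient Y₂ z₀)⟫_ℝ := by
    rw [hF z₀ hz₀, inner_add_left, real_inner_smul_left, real_inner_smul_left, f2, f3, mul_zero, add_zero]
  rw [e₁, e₂, f1, f2, (hI4 z₀ hz₀ hA0).1, mul_zero, add_zero] at h0
  -- `(l₁(l₁+1) − l₂(l₂+1)) λ |R₂|² = 0` with `λ ≠ 0`, `R₂ ≠ 0`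
  have hpos : 0 < ⟪cross z₀ (gradient Y₂ z₀), cross z₀ (gradient Y₂ z₀)⟫_ℝ := real_inner_self_pos.2 (hRW z₀ hz₀)
  have hlam0 : lam z₀ ≠ 0 := by
    intro h
    have := hAA z₀ hz₀
    rw [h, zero_pow three_ne_zero, zero_mul] at this
    exact hA0 this
  have hdeg := deg_mul_succ_ne hl
  have hprod : ((l₁ : ℝ) * ((l₁ : ℝ) + 1) - (l₂ : ℝ) * ((l₂ : ℝ) + 1)) *
      (lam z₀ * ⟪cross z₀ (gradient Y₂ z₀), cross z₀ (gradient Y₂ z₀)⟫_ℝ) = 0 := by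
    linear_combination h0
  rcases mul_eq_zero.1 hprod with h | h
  · exact hdeg (sub_eq_zero.1 h)
  · exact (mul_ne_zero hlam0 hpos.ne') h

end Engine

end Summit.NavierStokesRegularity.NavierStokesRegularity.Theorems.UnthreadedRigidity.CoZonal
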